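import Literature.Probability.Distributions.AEEqOfJointLaw
import Literature.Probability.Distributions.LintegralDeterminingClass
import Summits.CriticalPhenomena.CardyFormulaZ2.Theorems.CardyMeckeFlipFlipErgodicityZ2StubEquivariantVersionLatticeCovariance
import Summits.CriticalPhenomena.CardyFormulaZ2.Theorems.CardyMeckeFlipFlipErgodicityZ2StubEquivariantVersionPerturbation
import Summits.CriticalPhenomena.CardyFormulaZ2.Theorems.CardyMeckeFlipFlipErgodicityZ2StubKernelExistsZ2OfLatticeAeAntitoneOfLimit

/-!
# Crux `FlipErgodicityZ2` (stmt-CriticalPhenomena-14825), line `registered`, stub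
# `stub_equivariantVersion` (N7): almost-sure TRANSLATION equivariance of every joint-limit kernel

Route `Summits/CriticalPhenomena/CardyFormulaZ2/Theses/CardyMeckeFlip`.  Helper file (supports the
crux item).  Clause (ADM)(6) asks that the Garban–Pete–Schramm kernel `M ε` of a bond-`ℤ²` sublimit
`μ` be equivariant under ALL isometries of the plane; the registered stub `stub_equivariantVersion`
(an everywhere-equivariant admissible version) further needs the direction independence of the
two-scale four-arm ratio limits of the rotated grids (unprinted for `ℤ²`) and a Zimmer-type
strictification.  This file proves the provable half of the limit side:

**`ae_translate_equivariant_of_jointLimit`** — for a TRANSLATION-INVARIANT finite law `μ` on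
`ℋ_ℂ`, a mesh sequence `δ_k → 0⁺`, a cutoff `ε > 0`, and a measurable, locally `μ`-integrable
kernel `M ε` that is the joint limit in law of `(ω_{δ_k}, μ^ε_{δ_k}(ω))` (single-cutoff convergence
clause of `IsZ2PivotalKernelLimit`, one test function at a time), for every `v ∈ ℂ`:
`M ε (v + S) = (v + ·)_* (M ε S)` for `μ`-almost every `S`.  The registered headline
`ae_translate_equivariant` is its closed form (with the multi-test-function clause of the skeleton).

Proof (GPS 2013 §4.7, translation part).  For `φ ∈ C_c(ℂ)`, `ψ` bounded continuous on `ℋ_ℂ` and `χ`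
`1`-Lipschitz `[0,1]`-valued, with lattice approximations `w_k = δ_k t_k → v`:
`∫ ψ(S) χ(⟨M ε (v + S), φ⟩) dμ = ∫ ψ(S - v) χ(⟨M ε S, φ⟩) dμ` (invariance)
`= lim E[ψ(ω_{δ_k} - v) χ(⟨μ^ε_{δ_k}, φ⟩)]` (joint convergence)
`= lim E[ψ(ω_{δ_k} - w_k) χ(⟨μ^ε_{δ_k}, φ⟩)]` (`tendsto_integral_translate_mul_sub`: compact `ℋ_ℂ`)
`= lim E[ψ(ω_{δ_k}) χ(⟨μ^ε_{δ_k}, φ(w_k + ·)⟩)]` (EXACT, `jointLaw_translate_lattice`)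
`= lim E[ψ(ω_{δ_k}) χ(⟨μ^ε_{δ_k}, φ(v + ·)⟩)]` (`tendsto_integral_mul_comp_shift_sub`)
`= ∫ ψ(S) χ(⟨M ε S, φ(v + ·)⟩) dμ` (joint convergence);
so `⟨M ε (v + S), φ⟩ = ⟨M ε S, φ(v + ·)⟩` a.e. (`ae_eq_of_forall_integral_mul_eq`,
`Literature/Probability/Distributions/AEEqOfJointLaw.lean`), and a countable determining class of
`φ`'s (`exists_countable_determining_eq`) with a.e. local finiteness concludes.

References: C. Garban, G. Pete, O. Schramm, JAMS 26 (2013), arXiv:1008.1378, §1 p. 10, §4.7.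
-/

noncomputable section

open MeasureTheory Set Filter Metric
open Literature.Probability.Percolation Literature.Probability.Percolation.QuadCrossing
open Literature.Probability.LatticeModels Literature.Probability.Distributions
open Summit.CriticalPhenomena.CardyFormulaZ2.Cruxes.LagHandOff.CrosscutDictionary
open scoped ENNReal Topology BoundedContinuousFunction

namespace Summit.CriticalPhenomena.CardyFormulaZ2.Theorems.CardyMeckeFlip

/-! ### Translation-invariant laws on `ℋ_ℂ` -/

/-- Substitution `S ↦ v + S` under a translation-invariant law: `∫ F(v + S) dμ = ∫ F dμ` (for
every `F`; the translation is a Borel automorphism of `ℋ_ℂ`). [folklore] -/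
theorem integral_comp_translate_of_map_translate_eq {μ : Measure (QuadConfig (univ : Set ℂ))}
    {v : ℂ} (hinv : μ.map (QuadConfig.translate v) = μ) (F : QuadConfig (univ : Set ℂ) → ℝ) :
    ∫ S, F (QuadConfig.translate v S) ∂μ = ∫ S, F S ∂μ := by
  have h := integral_map_equiv (μ := μ) (QuadConfig.congrMeasurableEquiv (Homeomorph.addLeft v)) F
  rw [QuadConfig.coe_congrMeasurableEquiv] at h
  change ∫ S, F S ∂(μ.map (QuadConfig.translate v)) = ∫ S, F (QuadConfig.translate v S) ∂μ at h
  rw [hinv] at h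
  exact h.symm

/-- Almost-sure properties are stable under `S ↦ v + S` for a translation-invariant law.
[folklore] -/
theorem ae_comp_translate_of_map_translate_eq {μ : Measure (QuadConfig (univ : Set ℂ))} {v : ℂ}
    (hinv : μ.map (QuadConfig.translate v) = μ) {p : QuadConfig (univ : Set ℂ) → Prop}
    (h : ∀ᵐ S ∂μ, p S) : ∀ᵐ S ∂μ, p (QuadConfig.translate v S) := by
  have h' : ∀ᵐ S ∂(μ.map (QuadConfig.translate v)), p S := by rwa [hinv]
  exact (QuadConfig.congrMeasurableEquiv (Homeomorph.addLeft v)).measurableEmbedding.ae_map_iff.1 h'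

/-- The translate of a measure finite on compact sets is finite on compact sets. [folklore] -/
theorem isFiniteMeasureOnCompacts_map_const_add (m : Measure ℂ) [IsFiniteMeasureOnCompacts m]
    (v : ℂ) : IsFiniteMeasureOnCompacts (m.map fun x => v + x) :=
  ⟨fun K hK => by
    rw [Measure.map_apply (measurable_const_add v) hK.measurableSet]
    exact ((Homeomorph.addLeft v).isCompact_preimage.2 hK).measure_lt_top⟩

/-! ### The identity of joint laws on products `ψ ⊗ χ` -/

/-- **The joint laws of `(S, ⟨M ε (v + S), φ⟩)` and `(S, ⟨(v + ·)_* M ε S, φ⟩)` agree on products**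
`ψ(S) χ(r)`, `ψ` bounded continuous on `ℋ_ℂ`, `χ` `1`-Lipschitz with values in `[0,1]`, for a
translation-invariant `μ` and a measurable kernel `M ε` that is the single-cutoff joint limit in law
of the lattice kernels along `δ_k → 0⁺` (see the module docstring for the chain of equalities).
[folklore] -/
theorem integral_mul_comp_translate_eq_of_jointLimit
    (μ : FiniteMeasure (QuadConfig (univ : Set ℂ)))
    (M : ℝ → QuadConfig (univ : Set ℂ) → Measure ℂ) (δs : ℕ → ℝ) (hpos : ∀ k, 0 < δs k)
    (h0 : Tendsto δs atTop (𝓝 0))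
    (hinv : ∀ v : ℂ, (μ : Measure (QuadConfig (univ : Set ℂ))).map (QuadConfig.translate v) = μ)
    {ε : ℝ} (hε : 0 < ε) (hM : Measurable (M ε))
    (hjoint : ∀ φ : ℂ → ℝ, Continuous φ → HasCompactSupport φ →
      ∀ F : QuadConfig (univ : Set ℂ) × (Fin 1 → ℝ) →ᵇ ℝ,
        Tendsto (fun k => ∫ ω, F (z2QuadConfig (univ : Set ℂ) (δs k) ω,
            fun _ => ∫ x, φ x ∂(z2PivotalMeasure ε (δs k) ω)) ∂(bondPercolation (zdGraph 2) half))
          atTop (𝓝 (∫ S, F (S, fun _ => ∫ x, φ x ∂(M ε S))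
            ∂(μ : Measure (QuadConfig (univ : Set ℂ))))))
    (v : ℂ) {φ : ℂ → ℝ} (hφ : Continuous φ) (hφc : HasCompactSupport φ)
    (ψ : QuadConfig (univ : Set ℂ) →ᵇ ℝ) {χ : ℝ → ℝ} (hχ : LipschitzWith 1 χ)
    (hχ01 : ∀ r, χ r ∈ Icc (0 : ℝ) 1) :
    ∫ S, ψ S * χ (∫ x, φ x ∂(M ε (QuadConfig.translate v S)))
        ∂(μ : Measure (QuadConfig (univ : Set ℂ))) =
      ∫ S, ψ S * χ (∫ x, φ (v + x) ∂(M ε S)) ∂(μ : Measure (QuadConfig (univ : Set ℂ))) := by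
  haveI : IsProbabilityMeasure (bondPercolation (zdGraph 2) half) := by
    unfold bondPercolation; infer_instance
  -- lattice approximations `w_k = δ_k t_k → v`
  obtain ⟨w, hwdef⟩ : ∃ w : ℕ → ℂ, ∀ k, w k = meshPoint (δs k) (nearestSite (δs k) v) :=
    ⟨_, fun _ => rfl⟩
  have hw : Tendsto w atTop (𝓝 v) := by
    refine tendsto_iff_dist_tendsto_zero.2 (squeeze_zero (fun k => dist_nonneg) (fun k => ?_) h0)
    rw [hwdef k]
    exact dist_meshPoint_nearestSite_le (hpos k) v
  have hX : ∀ k, Measurable (z2QuadConfig (univ : Set ℂ) (δs k)) := fun k =>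
    measurable_z2QuadConfig isOpen_univ (hpos k)
  have hb : ∀ k, Measurable fun ω => ∫ x, φ x ∂(z2PivotalMeasure ε (δs k) ω) := fun k =>
    measurable_integral_z2PivotalMeasure hε (hpos k) hφ hφc
  have hχc : Continuous χ := hχ.continuous
  -- (i) left limit, tested with `ψ(· - v) ⊗ χ`
  obtain ⟨F₁, hF₁⟩ := exists_bcf_mul_comp
    (QuadConfig.continuous_mapHomeomorph (Homeomorph.addLeft (-v)) :
      Continuous (QuadConfig.translate (-v))) ψ hχc hχ01
  have h1 : Tendsto (fun k => ∫ ω, ψ (QuadConfig.translate (-v) (z2QuadConfig (univ : Set ℂ) (δs k) ω)) *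
      χ (∫ x, φ x ∂(z2PivotalMeasure ε (δs k) ω)) ∂(bondPercolation (zdGraph 2) half)) atTop
      (𝓝 (∫ S, ψ (QuadConfig.translate (-v) S) * χ (∫ x, φ x ∂(M ε S))
        ∂(μ : Measure (QuadConfig (univ : Set ℂ))))) := by
    have h := hjoint φ hφ hφc F₁
    simp only [hF₁] at h
    exact h
  -- (ii) right limit, test function `φ(v + ·)`, tested with `ψ ⊗ χ`
  obtain ⟨F₂, hF₂⟩ := exists_bcf_mul_comp continuous_id ψ hχc hχ01
  have h2 : Tendsto (fun k => ∫ ω, ψ (z2QuadConfig (univ : Set ℂ) (δs k) ω) *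
      χ (∫ x, φ (v + x) ∂(z2PivotalMeasure ε (δs k) ω)) ∂(bondPercolation (zdGraph 2) half)) atTop
      (𝓝 (∫ S, ψ S * χ (∫ x, φ (v + x) ∂(M ε S)) ∂(μ : Measure (QuadConfig (univ : Set ℂ))))) := by
    have h := hjoint (fun x => φ (v + x)) (hφ.comp (continuous_const_add v))
      (hφc.comp_homeomorph (Homeomorph.addLeft v)) F₂
    simp only [hF₂, id_eq] at h
    exact h
  -- (iii) `ψ(· - v)` against `ψ(· - w_k)`
  have h3 : Tendsto (fun k =>
      ∫ ω, ψ (QuadConfig.translate (-v) (z2QuadConfig (univ : Set ℂ) (δs k) ω)) *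
          χ (∫ x, φ x ∂(z2PivotalMeasure ε (δs k) ω)) ∂(bondPercolation (zdGraph 2) half) -
        ∫ ω, ψ (QuadConfig.translate (-w k) (z2QuadConfig (univ : Set ℂ) (δs k) ω)) *
          χ (∫ x, φ x ∂(z2PivotalMeasure ε (δs k) ω)) ∂(bondPercolation (zdGraph 2) half))
      atTop (𝓝 0) := by
    refine tendsto_integral_translate_mul_sub ψ hX
      (c := fun k ω => χ (∫ x, φ x ∂(z2PivotalMeasure ε (δs k) ω)))
      (fun k => hχc.measurable.comp (hb k)) (fun k ω => ?_) (a := fun _ => -v)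
      (b := fun k => -w k) ?_
    · rw [abs_of_nonneg (hχ01 _).1]
      exact (hχ01 _).2
    · simpa only [neg_sub_neg] using tendsto_sub_nhds_zero_iff.2 hw
  -- (iv) the exact lattice identity at `w_k`
  have h4 : ∀ k, ∫ ω, ψ (QuadConfig.translate (-w k) (z2QuadConfig (univ : Set ℂ) (δs k) ω)) *
      χ (∫ x, φ x ∂(z2PivotalMeasure ε (δs k) ω)) ∂(bondPercolation (zdGraph 2) half) =
      ∫ ω, ψ (z2QuadConfig (univ : Set ℂ) (δs k) ω) *
        χ (∫ x, φ (w k + x) ∂(z2PivotalMeasure ε (δs k) ω)) ∂(bondPercolation (zdGraph 2) half) := by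
    intro k
    rw [hwdef k]
    exact integral_comp_translate_eq_integral_comp_shift_testFunction (δs k) (nearestSite (δs k) v)
      (fun _ : Fin 1 => ε) (fun _ => φ) fun p => ψ p.1 * χ (p.2 0)
  -- (v) `φ(w_k + ·)` against `φ(v + ·)`
  have h5 := tendsto_integral_mul_comp_shift_sub μ M δs hpos hε hM hjoint hφ hφc v hw ψ hχ hχ01
  -- (vi) assemble
  have h6 : Tendsto (fun k => ∫ ω, ψ (QuadConfig.translate (-v) (z2QuadConfig (univ : Set ℂ) (δs k) ω)) *
      χ (∫ x, φ x ∂(z2PivotalMeasure ε (δs k) ω)) ∂(bondPercolation (zdGraph 2) half)) atTop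
      (𝓝 (∫ S, ψ S * χ (∫ x, φ (v + x) ∂(M ε S)) ∂(μ : Measure (QuadConfig (univ : Set ℂ))))) := by
    have h := (h3.add h5).add h2
    rw [zero_add, zero_add] at h
    refine h.congr fun k => ?_
    rw [h4 k]
    ring
  have h7 := tendsto_nhds_unique h1 h6
  rw [← h7, ← integral_comp_translate_of_map_translate_eq (hinv v)
    (fun S => ψ (QuadConfig.translate (-v) S) * χ (∫ x, φ x ∂(M ε S)))]
  simp only [translate_neg_translate]

/-! ### Almost-sure translation equivariance -/

/-- **Almost-sure translation equivariance of every joint-limit kernel.**  Let `μ` be a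
translation-invariant finite law on `ℋ_ℂ`, `δ_k → 0⁺` a mesh sequence, `ε > 0`, and `M ε` a
measurable kernel with locally `μ`-integrable masses that is the joint limit in law of
`(ω_{δ_k}, μ^ε_{δ_k}(ω))` (single cutoff, one test function at a time, bounded continuous test
functionals of `ℋ × ℝ¹`).  Then for every `v ∈ ℂ`, `M ε (v + S) = (v + ·)_* (M ε S)` for `μ`-almost
every `S` (the functionals `⟨·, φ⟩` agree a.e. for `φ` in a countable determining class, by
`integral_mul_comp_translate_eq_of_jointLimit` and `ae_eq_of_forall_integral_mul_eq`; both sides are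
a.e. locally finite). [folklore] -/
theorem ae_translate_equivariant_of_jointLimit
    (μ : FiniteMeasure (QuadConfig (univ : Set ℂ)))
    (M : ℝ → QuadConfig (univ : Set ℂ) → Measure ℂ) (δs : ℕ → ℝ) (hpos : ∀ k, 0 < δs k)
    (h0 : Tendsto δs atTop (𝓝 0))
    (hinv : ∀ v : ℂ, (μ : Measure (QuadConfig (univ : Set ℂ))).map (QuadConfig.translate v) = μ)
    {ε : ℝ} (hε : 0 < ε) (hM : Measurable (M ε))
    (hfin : ∀ r : ℝ,
      ∫⁻ S, M ε S (closedBall 0 r) ∂(μ : Measure (QuadConfig (univ : Set ℂ))) < ⊤)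
    (hjoint : ∀ φ : ℂ → ℝ, Continuous φ → HasCompactSupport φ →
      ∀ F : QuadConfig (univ : Set ℂ) × (Fin 1 → ℝ) →ᵇ ℝ,
        Tendsto (fun k => ∫ ω, F (z2QuadConfig (univ : Set ℂ) (δs k) ω,
            fun _ => ∫ x, φ x ∂(z2PivotalMeasure ε (δs k) ω)) ∂(bondPercolation (zdGraph 2) half))
          atTop (𝓝 (∫ S, F (S, fun _ => ∫ x, φ x ∂(M ε S))
            ∂(μ : Measure (QuadConfig (univ : Set ℂ))))))
    (v : ℂ) :
    ∀ᵐ S ∂(μ : Measure (QuadConfig (univ : Set ℂ))),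
      M ε (QuadConfig.translate v S) = (M ε S).map (fun x => v + x) := by
  haveI : HasOuterApproxClosed (QuadConfig (univ : Set ℂ)) :=
    QuadConfig.hasOuterApproxClosed isOpen_univ univ_nonempty
  -- a.e. equality of the functionals, test function by test function
  have hae : ∀ φ : ℂ → ℝ, Continuous φ → HasCompactSupport φ →
      ∀ᵐ S ∂(μ : Measure (QuadConfig (univ : Set ℂ))),
        ∫ x, φ x ∂(M ε (QuadConfig.translate v S)) = ∫ x, φ (v + x) ∂(M ε S) := by
    intro φ hφ hφc
    exact ae_eq_of_forall_integral_mul_eq (μ := (μ : Measure (QuadConfig (univ : Set ℂ))))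
      (f := fun S => ∫ x, φ x ∂(M ε (QuadConfig.translate v S)))
      (g := fun S => ∫ x, φ (v + x) ∂(M ε S))
      ((measurable_integral_of_measurable_measure hM hφ.stronglyMeasurable).comp
        (QuadConfig.measurable_translate v))
      (measurable_integral_of_measurable_measure hM
        (hφ.comp (continuous_const_add v)).stronglyMeasurable)
      fun ψ χ hχ hχ01 =>
        integral_mul_comp_translate_eq_of_jointLimit μ M δs hpos h0 hinv hε hM hjoint v hφ hφc ψ
          hχ hχ01
  -- the countable determining class and a.e. local finiteness
  obtain ⟨Φ, hΦc, hΦ, hdet⟩ := exists_countable_determining_eq ℂ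
  have hall : ∀ᵐ S ∂(μ : Measure (QuadConfig (univ : Set ℂ))), ∀ φ ∈ Φ,
      ∫ x, φ x ∂(M ε (QuadConfig.translate v S)) = ∫ x, φ (v + x) ∂(M ε S) :=
    (ae_ball_iff hΦc).2 fun φ hφΦ => hae φ (hΦ φ hφΦ).1 (hΦ φ hφΦ).2.1
  have hfinS : ∀ᵐ S ∂(μ : Measure (QuadConfig (univ : Set ℂ))), IsFiniteMeasureOnCompacts (M ε S) :=
    ae_isFiniteMeasureOnCompacts_of_lintegral_closedBall_lt_top hM hfin
  have hfinT : ∀ᵐ S ∂(μ : Measure (QuadConfig (univ : Set ℂ))),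
      IsFiniteMeasureOnCompacts (M ε (QuadConfig.translate v S)) :=
    ae_comp_translate_of_map_translate_eq (hinv v) hfinS
  filter_upwards [hall, hfinS, hfinT] with S hS hSfin hTfin
  haveI := hSfin
  haveI := hTfin
  haveI := isFiniteMeasureOnCompacts_map_const_add (M ε S) v
  refine hdet ((M ε S).map fun x => v + x) (M ε (QuadConfig.translate v S)) inferInstance
    inferInstance fun φ hφΦ => ?_
  obtain ⟨hφ, hφc, hφ01⟩ := hΦ φ hφΦ
  have hint : Integrable (fun x => φ (v + x)) (M ε S) :=
    (hφ.comp (continuous_const_add v)).integrable_of_hasCompactSupport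
      (hφc.comp_homeomorph (Homeomorph.addLeft v))
  rw [lintegral_map hφ.measurable.ennreal_ofReal (measurable_const_add v),
    ← ofReal_integral_eq_lintegral_ofReal (hφ.integrable_of_hasCompactSupport hφc)
      (ae_of_all _ fun x => (hφ01 x).1),
    ← ofReal_integral_eq_lintegral_ofReal hint (ae_of_all _ fun x => (hφ01 _).1), hS φ hφΦ]

/-- **Registered helper headline (N7, limit side for translations; verbatim signature)** —
almost-sure translation equivariance of every joint multi-cutoff limit kernel under a
translation-invariant `μ`: with the hypotheses of the skeleton's `stub_equivariantVersion`
(isometry invariance weakened to translation invariance, admissibility weakened to measurability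
and local integrability of `M ε`), for every cutoff `ε > 0` and `v ∈ ℂ`,
`M ε (v + S) = (v + ·)_* (M ε S)` for `μ`-a.e. `S`. [folklore] -/
theorem ae_translate_equivariant :
    ∀ (μ : FiniteMeasure (QuadConfig (Set.univ : Set ℂ)))
      (M : ℝ → QuadConfig (Set.univ : Set ℂ) → Measure ℂ) (δs : ℕ → ℝ),
      (∀ v : ℂ, Measure.map (QuadConfig.translate v) (μ : Measure (QuadConfig (Set.univ : Set ℂ))) =
        (μ : Measure (QuadConfig (Set.univ : Set ℂ)))) →
      (∀ k, 0 < δs k) → Tendsto δs atTop (𝓝 0) →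
        (∀ (m : ℕ) (εs : Fin m → ℝ) (φ : Fin m → ℂ → ℝ), (∀ j, 0 < εs j) → (∀ j, Continuous (φ j)) →
          (∀ j, HasCompactSupport (φ j)) →
            ∀ F : BoundedContinuousFunction (QuadConfig (Set.univ : Set ℂ) × (Fin m → ℝ)) ℝ,
              Tendsto
                (fun k => ∫ ω, F (z2QuadConfig (Set.univ : Set ℂ) (δs k) ω,
                    fun j => ∫ x, φ j x ∂(z2PivotalMeasure (εs j) (δs k) ω))
                  ∂(bondPercolation (zdGraph 2) half))
                atTop
                (𝓝 (∫ S, F (S, fun j => ∫ x, φ j x ∂(M (εs j) S))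
                  ∂(μ : Measure (QuadConfig (Set.univ : Set ℂ)))))) →
        ∀ ε : ℝ, 0 < ε → Measurable (M ε) →
          (∀ r : ℝ, ∫⁻ S, M ε S (closedBall 0 r) ∂(μ : Measure (QuadConfig (Set.univ : Set ℂ))) < ⊤) →
            ∀ v : ℂ, ∀ᵐ S ∂(μ : Measure (QuadConfig (Set.univ : Set ℂ))),
              M ε (QuadConfig.translate v S) = Measure.map (fun x => v + x) (M ε S) := by
  intro μ M δs hinv hpos h0 hjoint ε hε hM hfin v
  exact ae_translate_equivariant_of_jointLimit μ M δs hpos h0 hinv hε hM hfin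
    (fun φ hφ hφc F => hjoint 1 (fun _ => ε) (fun _ => φ) (fun _ => hε) (fun _ => hφ) (fun _ => hφc) F)
    v

end Summit.CriticalPhenomena.CardyFormulaZ2.Theorems.CardyMeckeFlip

end
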